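import Mathlib

/-!
# Route BarrierLever — item `PartitionMinorsHitByVP` (stmt-ValiantsHypothesis-19717), line `hidden-states`:
# BALL-DIAGONAL II — translated Möbius inversion on the Boolean lattice of a finite set (toolkit)

Helper file (`--supports stmt-ValiantsHypothesis-19717`; cell valiant-natproofs, rung V4, 𝒟-side door (c), registered line
`Cruxes/PartitionMinorsHitByVP/Lines/hidden_states.lean` v8; prover seat val-np-p6 gen 13). Definition-free; closes NO item.

CONTEXT (HOME/val-np-p6/g12/PROOF-balldiagonal-p6g12.md; the formalisation plan of this seat). The BALL-DIAGONAL theorem — the ball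
`B_{h−2}` on `h` states with the σ-table (p630805 `Tilt.exists_sigmaTable`) serves every down-set of co-size `h + 1` — is proved in the
kernel in ROW-KERNEL form: a coefficient vector `g` on the subsets of the non-core block `N` is recovered from the values
`Σ_{T ⊆ N} g T · ∏_{a ∈ T} ([a ∈ I] − θ_a)` (a multilinear polynomial evaluated at the translated 0/1 points `1_I − θ`). This file is the
toolkit, for an arbitrary finite set `N` in a type with decidable equality:

* `sum_prod_indicator_sub_eq` — EXPANSION: `Σ_{T ⊆ N} g T ∏_{a∈T}([a ∈ I] − θ_a) = Σ_{A ⊆ I} g′ A` with the TRANSLATE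
  `g′ A = Σ_{A ⊆ T ⊆ N} g T ∏_{a ∈ T∖A} (−θ_a)` (`Z_θ = L · ζ`, `L` binomial, `ζ` the zeta matrix);
* `eq_zero_of_sum_subsets` — Möbius inversion on a DOWN-SET `𝒟` (subset form): `Σ_{A ⊆ I} c A = 0` for all `I ∈ 𝒟` forces `c = 0` on `𝒟`;
* `translate_eq_zero` — the two combined: vanishing of the evaluations on a down-set `𝒟 ⊆ 2^N` kills the translate on `𝒟`;
* `translate_inversion` — the INVERSE translation `g T = Σ_{T ⊆ A ⊆ N} g′ A ∏_{a ∈ A∖T} θ_a` (binomial theorem `Σ_B θ^B (−θ)^{S∖B} = 0^{|S|}`);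
* `sum_univ_eq_sum_union` — splitting a sum over all subsets along a fixed set `C`: `S ↦ (S ∩ C, S ∖ C)`.

WHAT THIS IS NOT: bookkeeping for the sequel files (face-poset system, block kernel theorem, diagonal cells); nothing on crux 14610 or VP ≠ VNP.
-/

set_option linter.dupNamespace false

namespace Summit.ValiantsHypothesis.ValiantsHypothesis.Theorems.BarrierLever.HiddenStates

open Finset

noncomputable section

namespace BallDiag

variable {α : Type*} [DecidableEq α]

/-- A product of membership indicators is the indicator of inclusion. -/
theorem prod_indicator_eq (A I : Finset α) :
    ∏ a ∈ A, (if a ∈ I then (1 : ℂ) else 0) = if A ⊆ I then 1 else 0 := by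
  rw [Finset.prod_boole]
  by_cases h : A ⊆ I
  · rw [if_pos h, if_pos (fun a ha => h ha)]
  · rw [if_neg h, if_neg (fun h' => h (fun a ha => h' a ha))]

/-- A sum over the subsets of `T ⊆ N` as an indicator-weighted sum over the subsets of `N`. -/
theorem sum_powerset_eq_sum_ite (N T : Finset α) (hT : T ⊆ N) (f : Finset α → ℂ) :
    ∑ A ∈ T.powerset, f A = ∑ A ∈ N.powerset, if A ⊆ T then f A else 0 := by
  rw [← Finset.sum_filter]
  congr 1
  ext A
  simp only [Finset.mem_powerset, Finset.mem_filter]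
  exact ⟨fun h => ⟨h.trans hT, h⟩, fun h => h.2⟩

/-- **EXPANSION.** For `I ⊆ N`:
`Σ_{T ⊆ N} g T · ∏_{a ∈ T} ([a ∈ I] − θ_a) = Σ_{A ⊆ I} Σ_{A ⊆ T ⊆ N} g T · ∏_{a ∈ T ∖ A} (−θ_a)`. -/
theorem sum_prod_indicator_sub_eq (N I : Finset α) (hI : I ⊆ N) (g : Finset α → ℂ) (θ : α → ℂ) :
    ∑ T ∈ N.powerset, g T * ∏ a ∈ T, ((if a ∈ I then (1 : ℂ) else 0) - θ a)
      = ∑ A ∈ I.powerset, ∑ T ∈ N.powerset with A ⊆ T, g T * ∏ a ∈ T \ A, (-θ a) := by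
  -- expand each product binomially
  have hexp : ∀ T ∈ N.powerset, g T * ∏ a ∈ T, ((if a ∈ I then (1 : ℂ) else 0) - θ a)
      = ∑ A ∈ N.powerset, if A ⊆ T then g T * ((if A ⊆ I then (1 : ℂ) else 0) * ∏ a ∈ T \ A, (-θ a)) else 0 := by
    intro T hT
    have h1 : ∀ a ∈ T, ((if a ∈ I then (1 : ℂ) else 0) - θ a) = (if a ∈ I then (1 : ℂ) else 0) + (-θ a) := by
      intro a _; ring
    rw [Finset.prod_congr rfl h1, Finset.prod_add, Finset.mul_sum,
      sum_powerset_eq_sum_ite N T (Finset.mem_powerset.mp hT)]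
    refine Finset.sum_congr rfl fun A _ => ?_
    by_cases hAT : A ⊆ T
    · rw [if_pos hAT, if_pos hAT, prod_indicator_eq]
    · rw [if_neg hAT, if_neg hAT]
  rw [Finset.sum_congr rfl hexp, Finset.sum_comm]
  -- only `A ⊆ I` contribute
  symm
  rw [← Finset.sum_subset (Finset.powerset_mono.mpr hI)]
  · refine Finset.sum_congr rfl fun A hA => ?_
    have hAI : A ⊆ I := Finset.mem_powerset.mp hA
    rw [Finset.sum_filter]
    refine Finset.sum_congr rfl fun T _ => ?_
    by_cases hAT : A ⊆ T
    · rw [if_pos hAT, if_pos hAT, if_pos hAI, one_mul]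
    · rw [if_neg hAT, if_neg hAT]
  · intro A _ hAI
    have hAI' : ¬ A ⊆ I := fun h => hAI (Finset.mem_powerset.mpr h)
    refine Finset.sum_eq_zero fun T _ => ?_
    by_cases hAT : A ⊆ T
    · rw [if_pos hAT, if_neg hAI', zero_mul, mul_zero]
    · rw [if_neg hAT]

/-- **Möbius inversion on a down-set (subset form).** If `Σ_{A ⊆ I} c A = 0` for every member `I` of a down-closed family `𝒟`,
then `c` vanishes on `𝒟`. -/
theorem eq_zero_of_sum_subsets (𝒟 : Finset (Finset α)) (hdown : ∀ I ∈ 𝒟, ∀ A, A ⊆ I → A ∈ 𝒟)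
    (c : Finset α → ℂ) (hc : ∀ I ∈ 𝒟, ∑ A ∈ I.powerset, c A = 0) : ∀ A ∈ 𝒟, c A = 0 := by
  intro A
  induction A using Finset.strongInduction with
  | H A ih =>
    intro hA
    have h1 := hc A hA
    rw [← Finset.sum_erase_add _ _ (Finset.mem_powerset.mpr (subset_refl A))] at h1
    have h2 : ∑ A' ∈ (A.powerset).erase A, c A' = 0 := by
      refine Finset.sum_eq_zero fun A' hA' => ?_
      obtain ⟨hne, hsub⟩ := Finset.mem_erase.mp hA'
      have hss : A' ⊂ A := lt_of_le_of_ne (Finset.mem_powerset.mp hsub) hne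
      exact ih A' hss (hdown A hA A' hss.le)
    rwa [h2, zero_add] at h1

/-- **TRANSLATED MÖBIUS INVERSION.** `𝒟 ⊆ 2^N` down-closed; if `Σ_{T ⊆ N} g T ∏_{a ∈ T} ([a ∈ I] − θ_a) = 0` for every `I ∈ 𝒟`,
then the translate `g′ A = Σ_{A ⊆ T ⊆ N} g T ∏_{a ∈ T ∖ A} (−θ_a)` vanishes at every `A ∈ 𝒟`. -/
theorem translate_eq_zero (N : Finset α) (𝒟 : Finset (Finset α)) (h𝒟N : ∀ I ∈ 𝒟, I ⊆ N)
    (hdown : ∀ I ∈ 𝒟, ∀ A, A ⊆ I → A ∈ 𝒟) (g : Finset α → ℂ) (θ : α → ℂ)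
    (hg : ∀ I ∈ 𝒟, ∑ T ∈ N.powerset, g T * ∏ a ∈ T, ((if a ∈ I then (1 : ℂ) else 0) - θ a) = 0) :
    ∀ A ∈ 𝒟, ∑ T ∈ N.powerset with A ⊆ T, g T * ∏ a ∈ T \ A, (-θ a) = 0 :=
  eq_zero_of_sum_subsets 𝒟 hdown _ fun I hI => by
    rw [← sum_prod_indicator_sub_eq N I (h𝒟N I hI) g θ]
    exact hg I hI

/-- **The binomial kernel**: for `T, T' ⊆ N`,
`Σ_{A ⊆ N} [T ⊆ A ⊆ T'] · ∏_{a ∈ T' ∖ A} (−θ_a) · ∏_{a ∈ A ∖ T} θ_a = [T' = T]`. -/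
theorem sum_interval_prod_neg_prod (N T T' : Finset α) (hT' : T' ⊆ N) (θ : α → ℂ) :
    ∑ A ∈ N.powerset, (if T ⊆ A ∧ A ⊆ T' then (∏ a ∈ T' \ A, (-θ a)) * ∏ a ∈ A \ T, θ a else 0)
      = if T' = T then 1 else 0 := by
  by_cases hTT' : T ⊆ T'
  · -- substitute `A = T ∪ B`, `B ⊆ T' \ T`
    rw [← Finset.sum_filter]
    have hbij : ∑ A ∈ N.powerset with (T ⊆ A ∧ A ⊆ T'), (∏ a ∈ T' \ A, (-θ a)) * ∏ a ∈ A \ T, θ a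
        = ∑ B ∈ (T' \ T).powerset, (∏ a ∈ B, θ a) * ∏ a ∈ (T' \ T) \ B, (-θ a) := by
      refine Finset.sum_nbij' (fun A => A \ T) (fun B => T ∪ B) ?_ ?_ ?_ ?_ ?_
      · intro A hA
        obtain ⟨-, -, hAT'⟩ := Finset.mem_filter.mp hA
        exact Finset.mem_powerset.mpr (Finset.sdiff_subset_sdiff hAT' (subset_refl T))
      · intro B hB
        have hB' : B ⊆ T' \ T := Finset.mem_powerset.mp hB
        refine Finset.mem_filter.mpr ⟨Finset.mem_powerset.mpr ?_, Finset.subset_union_left, ?_⟩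
        · exact Finset.union_subset (hTT'.trans hT') ((hB'.trans Finset.sdiff_subset).trans hT')
        · exact Finset.union_subset hTT' (hB'.trans Finset.sdiff_subset)
      · intro A hA
        obtain ⟨-, hTA, -⟩ := Finset.mem_filter.mp hA
        exact Finset.union_sdiff_of_subset hTA
      · intro B hB
        have hB' : B ⊆ T' \ T := Finset.mem_powerset.mp hB
        rw [Finset.union_sdiff_left]
        exact Finset.sdiff_eq_self_of_disjoint (Finset.disjoint_of_subset_left hB' Finset.sdiff_disjoint)
      · intro A hA
        obtain ⟨-, hTA, hAT'⟩ := Finset.mem_filter.mp hA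
        have hsd : (T' \ T) \ (A \ T) = T' \ A := by
          ext x
          simp only [Finset.mem_sdiff]
          constructor
          · rintro ⟨⟨hxT', hxT⟩, hx⟩
            exact ⟨hxT', fun hxA => hx ⟨hxA, hxT⟩⟩
          · rintro ⟨hxT', hxA⟩
            exact ⟨⟨hxT', fun hxT => hxA (hTA hxT)⟩, fun hx => hxA hx.1⟩
        rw [hsd, mul_comm]
    rw [hbij, ← Finset.prod_add]
    have h0 : ∏ a ∈ T' \ T, (θ a + -θ a) = (0 : ℂ) ^ (T' \ T).card := by
      rw [← Finset.prod_const]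
      exact Finset.prod_congr rfl fun a _ => by ring
    rw [h0, zero_pow_eq]
    by_cases hE : T' = T
    · subst hE; simp
    · have hne : (T' \ T).card ≠ 0 := by
        intro hc
        apply hE
        rw [Finset.card_eq_zero, Finset.sdiff_eq_empty_iff_subset] at hc
        exact Finset.Subset.antisymm hc hTT'
      rw [if_neg hne, if_neg hE]
  · have hne : T' ≠ T := fun h => hTT' (h ▸ subset_refl T)
    rw [if_neg hne]
    refine Finset.sum_eq_zero fun A _ => ?_
    rw [if_neg]
    rintro ⟨hTA, hAT'⟩
    exact hTT' (hTA.trans hAT')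

/-- **INVERSE TRANSLATION.** For `T ⊆ N`: `g T = Σ_{T ⊆ A ⊆ N} g′ A · ∏_{a ∈ A ∖ T} θ_a`, where
`g′ A = Σ_{A ⊆ T' ⊆ N} g T' ∏_{a ∈ T' ∖ A} (−θ_a)` is the translate of `sum_prod_indicator_sub_eq`. -/
theorem translate_inversion (N T : Finset α) (hT : T ⊆ N) (g : Finset α → ℂ) (θ : α → ℂ) :
    g T = ∑ A ∈ N.powerset with T ⊆ A,
      (∑ T' ∈ N.powerset with A ⊆ T', g T' * ∏ a ∈ T' \ A, (-θ a)) * ∏ a ∈ A \ T, θ a := by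
  -- write the right-hand side as a double indicator sum and exchange
  have h1 : ∑ A ∈ N.powerset with T ⊆ A,
      (∑ T' ∈ N.powerset with A ⊆ T', g T' * ∏ a ∈ T' \ A, (-θ a)) * ∏ a ∈ A \ T, θ a
      = ∑ A ∈ N.powerset, ∑ T' ∈ N.powerset,
          if T ⊆ A ∧ A ⊆ T' then g T' * ((∏ a ∈ T' \ A, (-θ a)) * ∏ a ∈ A \ T, θ a) else 0 := by
    rw [Finset.sum_filter]
    refine Finset.sum_congr rfl fun A _ => ?_
    by_cases hTA : T ⊆ A
    · rw [if_pos hTA, Finset.sum_filter, Finset.sum_mul]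
      refine Finset.sum_congr rfl fun T' _ => ?_
      by_cases hAT' : A ⊆ T'
      · rw [if_pos hAT', if_pos ⟨hTA, hAT'⟩, mul_assoc]
      · rw [if_neg hAT', if_neg (fun h => hAT' h.2), zero_mul]
    · rw [if_neg hTA]
      symm
      exact Finset.sum_eq_zero fun T' _ => by rw [if_neg (fun h => hTA h.1)]
  rw [h1, Finset.sum_comm]
  have h2 : ∀ T' ∈ N.powerset, ∑ A ∈ N.powerset,
      (if T ⊆ A ∧ A ⊆ T' then g T' * ((∏ a ∈ T' \ A, (-θ a)) * ∏ a ∈ A \ T, θ a) else 0)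
      = g T' * if T' = T then 1 else 0 := by
    intro T' hT'
    rw [← sum_interval_prod_neg_prod N T T' (Finset.mem_powerset.mp hT') θ, Finset.mul_sum]
    refine Finset.sum_congr rfl fun A _ => ?_
    by_cases h : T ⊆ A ∧ A ⊆ T'
    · rw [if_pos h, if_pos h]
    · rw [if_neg h, if_neg h, mul_zero]
  rw [Finset.sum_congr rfl h2]
  simp_rw [mul_boole]
  rw [Finset.sum_ite_eq', if_pos (Finset.mem_powerset.mpr hT)]

/-- **Splitting a sum over all subsets along a fixed set `C`**: `S ↦ (S ∩ C, S ∖ C)` is a bijection onto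
`2^C × 2^{Cᶜ}`, so `Σ_S f S = Σ_{D ⊆ C} Σ_{T ⊆ univ ∖ C} f (D ∪ T)`. -/
theorem sum_univ_eq_sum_union {β : Type*} [Fintype β] [DecidableEq β] (C : Finset β) (f : Finset β → ℂ) :
    ∑ S, f S = ∑ D ∈ C.powerset, ∑ T ∈ (Finset.univ \ C).powerset, f (D ∪ T) := by
  rw [← Finset.sum_product' (f := fun D T => f (D ∪ T))]
  refine Finset.sum_nbij' (fun S => (S ∩ C, S \ C)) (fun x => x.1 ∪ x.2) ?_ ?_ ?_ ?_ ?_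
  · intro S _
    simp only [Finset.mem_product, Finset.mem_powerset]
    exact ⟨Finset.inter_subset_right, Finset.sdiff_subset_sdiff (Finset.subset_univ S) (subset_refl C)⟩
  · intro x _; exact Finset.mem_univ _
  · intro S _
    show S ∩ C ∪ S \ C = S
    rw [Finset.union_comm]; exact Finset.sdiff_union_inter S C
  · intro x hx
    obtain ⟨hD, hT⟩ := Finset.mem_product.mp hx
    have hD' : x.1 ⊆ C := Finset.mem_powerset.mp hD
    have hT' : Disjoint x.2 C := by
      have := Finset.mem_powerset.mp hT
      exact Finset.disjoint_of_subset_left this Finset.sdiff_disjoint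
    show ((x.1 ∪ x.2) ∩ C, (x.1 ∪ x.2) \ C) = x
    ext a
    · simp only [Finset.mem_inter, Finset.mem_union]
      constructor
      · rintro ⟨h | h, hC⟩
        · exact h
        · exact absurd hC (Finset.disjoint_left.mp hT' h)
      · intro h; exact ⟨Or.inl h, hD' h⟩
    · simp only [Finset.mem_sdiff, Finset.mem_union]
      constructor
      · rintro ⟨h | h, hC⟩
        · exact absurd (hD' h) hC
        · exact h
      · intro h; exact ⟨Or.inr h, Finset.disjoint_left.mp hT' h⟩
  · intro S _
    show f S = f (S ∩ C ∪ S \ C)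
    rw [Finset.union_comm, Finset.sdiff_union_inter]

end BallDiag

end

end Summit.ValiantsHypothesis.ValiantsHypothesis.Theorems.BarrierLever.HiddenStates
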